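import Summits.QuantumFields.YangMills.Theorems.PoincareLipschitzHSystemGapAlgebra
import Summits.QuantumFields.YangMills.Theorems.PoincareLipschitzHSystemEnergyIdentity
import Literature.Analysis.FunctionSpaces.MeyersSerrinProofs
import Literature.Analysis.FluidPDE.CKNPressureHessianSlice
import Mathlib.MeasureTheory.Function.LocallyIntegrable
import HarnessLib

/-!
# Crux `BlockLipschitzL` (stmt-QuantumFields-23533) ∕ `HistoryTailL` (stmt-QuantumFields-19936), LINE 25 «CompactnessTransfer»,
# stub S1″ — the (GAP) socket, ROAD (W) «Wente at 3π», brick (W-KNIT-DOOR) «THE 3π GAP FROM THE TWO DOORS»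

Cell `ym3-torus` (YM ladder rung R3 = continuum SU(2) Yang–Mills on T³ — a RUNG, NOT Clay: not d = 4, not infinite volume,
not a mass gap); WIDTH helper seat `ym-ust-19936-w3` g16 (road owner of ROAD (W)); `--supports stmt-QuantumFields-23533`;
THEOREMS ONLY (0 `def`, 0 `sorry`, default heartbeats); imports ✓(W-ALG) `…PoincareLipschitzHSystemGapAlgebra`, ✓(W-EN) px3 g10's `…PoincareLipschitzHSystemEnergyIdentity`, lit
✓`MeyersSerrinProofs` (`hasWeakFDerivOn_congr_ae`), lit ✓`CKNPressureHessianSlice` (`HasWeakFDerivOn.clm_comp`), Mathlib.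

THE POINT.  ROAD (W) (memo `ROAD-W-WENTE-3PI-w3g16.md`, 23533 evidence) proves the socket of record
  `hSystem_energy_zero_of_le_three_pi (hB : (i)) (hB2 : (i′)) (hE : (ii)) (hH : (iii)) (hΘ : ∫Σ‖GB e_k‖² ≤ 3π) : ∫Σ‖GB e_k‖² = 0`
(rows (i)(ii)(iii) = the hypothesis rows of `Literature.Analysis.PDE.HSystemEnergyQuantization` VERBATIM, (i′) = `B ∈ L²_loc`)
from two analytic bricks typed by other pens — (W-TWO) the SHARP TWO-POINT WENTE bound for a scalar configuration
`Δu = 2 det(∇a, ∇b)` (`u` has a continuous representative `ū` with `|ū x₀ − ū x₁| ≤ (1∕π)‖∇a‖₂‖∇b‖₂`; pens w7 g15 W-ONE, w4 g16 W-INV,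
px22 g8 W-TWO, px6 g10 W-WIR) and (W-EN) the ENERGY IDENTITY `∫Σ‖GB e_k‖² = −2 Σ_a ∫ (B^a − c_a) f_a` for continuous bounded `B`
(pen px3 g10) — and the landed algebraic knit ✓(W-ALG) `energy_zero_of_osc_of_energyBound`.  THIS FILE IS THE KNIT FROM THE TWO
REMAINING DOOR: (W-EN) is ALREADY a tree theorem (px3 g10 ✓`…HSystemEnergyIdentity.energy_le_abs`, the frozen `hEn` shape), so only
(W-TWO) enters as a HYPOTHESIS (`doorTWO`, its exact frozen text); when the W-ONE∕W-INV∕W-TWO bricks land, the socket of record is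
ONE `exact hSystem_energy_zero_of_le_three_pi_of_doorTWO doorTWO_holds` away (file `…HSystemGapAtThreePi`).
Steps: componentwise scalar data of `B` (`HasWeakFDerivOn.clm_comp` with `EuclideanSpace.proj a`), `doorTWO` per component ⇒
continuous representatives `ū_a` with the two-point bound ⇒ midpoint constants `c_a` with `|ū_a − c_a| ≤ (1∕2π)‖∇B^{a+1}‖₂‖∇B^{a+2}‖₂`
⇒ the continuous bounded representative `B̄ = B` a.e. (`hasWeakFDerivOn_congr_ae`) ⇒ ✓`energy_le_abs` at `B̄` ⇒ rows `hOsc`, `hEn` of ✓(W-ALG).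

HONEST SCOPE.  The door (W-TWO) is a HYPOTHESIS here (bricks W-ONE∕W-INV∕W-TWO in flight); nothing of (W-OSC)∕the socket∕(GAP)∕(TM)∕S1″∕K1∕
`BlockLipschitzL`∕`HistoryTailL` is proved unconditionally by this file.  YM₃ on T³ is rung R3, not Clay; YM gap NOT proved;
no summit statement is proved here.

References: H. Wente (1969); H. Brezis, J.-M. Coron, ARMA 89 (1985) [BrezisCoron1985] (App. Lemma A.1 — the named fact this road
replaces below 3π); P. Topping, Comment. Math. Helv. 72 (1997) [Topping1997] (the constant 1∕2π).
-/

set_option autoImplicit false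

noncomputable section

open MeasureTheory Set Function Filter Topology TopologicalSpace
open scoped ContDiff BigOperators

namespace Summit.QuantumFields.YangMills.Theorems.PoincareLipschitzHSystemGapAtThreePiOfDoors

open Literature.Analysis.FunctionSpaces
open Summit.QuantumFields.YangMills.Theorems.PoincareLipschitzHSystemGapAlgebraLetters
open Summit.QuantumFields.YangMills.Theorems.PoincareLipschitzHSystemGapAlgebra

/-! ## §1 Two soft letters -/

/-- **Midpoint constant**: a real function with all two-point differences `≤ K` is within `K∕2` of one constant. [folklore] -/
theorem exists_const_abs_sub_le_half {X : Type*} [Nonempty X] (f : X → ℝ) {K : ℝ}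
    (h : ∀ x₀ x₁, |f x₀ - f x₁| ≤ K) : ∃ c : ℝ, ∀ x, |f x - c| ≤ K / 2 := by
  obtain ⟨xs⟩ := ‹Nonempty X›
  have hbdd_above : BddAbove (Set.range f) := by
    refine ⟨f xs + K, ?_⟩
    rintro _ ⟨x, rfl⟩
    have := h x xs; rw [abs_le] at this; linarith
  have hbdd_below : BddBelow (Set.range f) := by
    refine ⟨f xs - K, ?_⟩
    rintro _ ⟨x, rfl⟩
    have := h x xs; rw [abs_le] at this; linarith
  set S := sSup (Set.range f) with hS
  set I := sInf (Set.range f) with hI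
  have hle : ∀ x, f x ≤ S := fun x => le_csSup hbdd_above ⟨x, rfl⟩
  have hge : ∀ x, I ≤ f x := fun x => csInf_le hbdd_below ⟨x, rfl⟩
  have hSI : S - I ≤ K := by
    -- `S ≤ f x₁ + K` for every `x₁`, hence `S - K ≤ I`
    have h1 : ∀ x₁, S ≤ f x₁ + K := fun x₁ =>
      csSup_le (Set.range_nonempty f) (by rintro _ ⟨x₀, rfl⟩; have := h x₀ x₁; rw [abs_le] at this; linarith)
    have h2 : S - K ≤ I := le_csInf (Set.range_nonempty f) (by rintro _ ⟨x₁, rfl⟩; linarith [h1 x₁])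
    linarith
  refine ⟨(S + I) / 2, fun x => ?_⟩
  rw [abs_le]
  constructor <;> linarith [hle x, hge x]

/-- `ℓ² ≤ ℓ¹` on `E³`: `‖v‖ ≤ |v 0| + |v 1| + |v 2|`. [folklore] -/
theorem norm_le_sum_abs_fin_three (v : EuclideanSpace ℝ (Fin 3)) : ‖v‖ ≤ |v 0| + |v 1| + |v 2| := by
  have hsq : ‖v‖ ^ 2 = (v 0) ^ 2 + (v 1) ^ 2 + (v 2) ^ 2 := by
    rw [norm_sq_eq_sum_sq_fin_three, Fin.sum_univ_three]
  have hnn : 0 ≤ |v 0| + |v 1| + |v 2| := by positivity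
  nlinarith [sq_abs (v 0), sq_abs (v 1), sq_abs (v 2), abs_nonneg (v 0), abs_nonneg (v 1), abs_nonneg (v 2),
    norm_nonneg v, sq_nonneg (‖v‖ - (|v 0| + |v 1| + |v 2|))]

/-- The coordinate functions of a Sobolev map `E² → E³` are Sobolev, with the coordinate rows of the weak gradient. [folklore] -/
theorem hasWeakFDerivOn_coord3 {B : EuclideanSpace ℝ (Fin 2) → EuclideanSpace ℝ (Fin 3)}
    {GB : EuclideanSpace ℝ (Fin 2) → (EuclideanSpace ℝ (Fin 2) →L[ℝ] EuclideanSpace ℝ (Fin 3))}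
    (hB : HasWeakFDerivOn ⟨Set.univ, isOpen_univ⟩ volume B GB) (a : Fin 3) :
    HasWeakFDerivOn (⟨Set.univ, isOpen_univ⟩ : Opens (EuclideanSpace ℝ (Fin 2))) volume (fun y => B y a)
      (fun y => (EuclideanSpace.proj a).comp (GB y)) := by
  have := hB.clm_comp (EuclideanSpace.proj a)
  simpa using this

/-! ## §2 The socket of record from the two doors -/

/-- **(W-KNIT-DOOR) The `H`-system energy gap at `3π` from the two-point Wente door of ROAD (W).**  DOOR (hypothesis, the
brick's frozen export text): `doorTWO` = the sharp two-point Wente bound for scalar configurations `(u; a, b)` on `ℝ²` with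
`Δu = 2 det(∇a,∇b)` weakly (`u` a.e. equals a continuous `ū` with `|ū x₀ − ū x₁| ≤ (1∕π)‖∇a‖₂‖∇b‖₂`); the energy row (W-EN) is
px3 g10's tree theorem ✓`PoincareLipschitzHSystemEnergyIdentity.energy_le_abs`.  CONCLUSION: for `B : ℝ² → ℝ³` with weak gradient `GB` on `ℝ²` (i), `B ∈ L²_loc` (i′), integrable energy density
(ii) and the weak `H`-system (iii) — rows (i)(ii)(iii) being those of `Literature.Analysis.PDE.HSystemEnergyQuantization` —
`∫Σ‖GB e_k‖² ≤ 3π ⇒ ∫Σ‖GB e_k‖² = 0`.  Proof: door + ✓`energy_le_abs` ⇒ rows `hOsc`, `hEn` of ✓`energy_zero_of_osc_of_energyBound` for the continuous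
representative. [cite: Topping1997, Theorem 1 (constant 1∕2π); BrezisCoron1985, Appendix Lemma A.1 (replaced below 3π)] -/
theorem hSystem_energy_zero_of_le_three_pi_of_doorTWO
    (doorTWO : ∀ (u a b : EuclideanSpace ℝ (Fin 2) → ℝ)
      (Gu Ga Gb : EuclideanSpace ℝ (Fin 2) → (EuclideanSpace ℝ (Fin 2) →L[ℝ] ℝ)),
      HasWeakFDerivOn ⟨Set.univ, isOpen_univ⟩ volume u Gu →
      HasWeakFDerivOn ⟨Set.univ, isOpen_univ⟩ volume a Ga →
      HasWeakFDerivOn ⟨Set.univ, isOpen_univ⟩ volume b Gb →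
      LocallyIntegrable (fun y => u y ^ 2) volume →
      LocallyIntegrable (fun y => a y ^ 2) volume →
      LocallyIntegrable (fun y => b y ^ 2) volume →
      Integrable (fun y => ∑ k : Fin 2, (Gu y (EuclideanSpace.single k (1:ℝ))) ^ 2) volume →
      Integrable (fun y => ∑ k : Fin 2, (Ga y (EuclideanSpace.single k (1:ℝ))) ^ 2) volume →
      Integrable (fun y => ∑ k : Fin 2, (Gb y (EuclideanSpace.single k (1:ℝ))) ^ 2) volume →
      (∀ η : EuclideanSpace ℝ (Fin 2) → ℝ, ContDiff ℝ ∞ η → HasCompactSupport η →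
        -(∫ y, ∑ k : Fin 2, fderiv ℝ η y (EuclideanSpace.single k (1:ℝ)) * Gu y (EuclideanSpace.single k (1:ℝ))) =
          2 * ∫ y, η y * (Ga y (EuclideanSpace.single 0 (1:ℝ)) * Gb y (EuclideanSpace.single 1 (1:ℝ)) -
            Ga y (EuclideanSpace.single 1 (1:ℝ)) * Gb y (EuclideanSpace.single 0 (1:ℝ)))) →
      ∃ ū : EuclideanSpace ℝ (Fin 2) → ℝ, Continuous ū ∧ ū =ᵐ[volume] u ∧
        ∀ x₀ x₁, |ū x₀ - ū x₁| ≤ 1 / Real.pi *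
          (Real.sqrt (∫ y, ∑ k : Fin 2, (Ga y (EuclideanSpace.single k (1:ℝ))) ^ 2) *
           Real.sqrt (∫ y, ∑ k : Fin 2, (Gb y (EuclideanSpace.single k (1:ℝ))) ^ 2)))
    {B : EuclideanSpace ℝ (Fin 2) → EuclideanSpace ℝ (Fin 3)}
    {GB : EuclideanSpace ℝ (Fin 2) → (EuclideanSpace ℝ (Fin 2) →L[ℝ] EuclideanSpace ℝ (Fin 3))}
    (hB : HasWeakFDerivOn ⟨Set.univ, isOpen_univ⟩ volume B GB)
    (hB2 : LocallyIntegrable (fun y => ‖B y‖ ^ 2) volume)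
    (hE : Integrable (fun y => ∑ k : Fin 2, ‖GB y (EuclideanSpace.single k (1:ℝ))‖ ^ 2) volume)
    (hH : ∀ (η : EuclideanSpace ℝ (Fin 2) → ℝ), ContDiff ℝ ∞ η → HasCompactSupport η → ∀ a : Fin 3,
      -(∫ y, ∑ k : Fin 2, fderiv ℝ η y (EuclideanSpace.single k (1:ℝ)) * (GB y (EuclideanSpace.single k (1:ℝ))) a) =
        2 * ∫ y, η y * ((GB y (EuclideanSpace.single 0 (1:ℝ))) (a + 1) * (GB y (EuclideanSpace.single 1 (1:ℝ))) (a + 2) -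
          (GB y (EuclideanSpace.single 0 (1:ℝ))) (a + 2) * (GB y (EuclideanSpace.single 1 (1:ℝ))) (a + 1)))
    (hΘ : ∫ y, ∑ k : Fin 2, ‖GB y (EuclideanSpace.single k (1:ℝ))‖ ^ 2 ≤ 3 * Real.pi) :
    ∫ y, ∑ k : Fin 2, ‖GB y (EuclideanSpace.single k (1:ℝ))‖ ^ 2 = 0 := by
  have hGm : AEStronglyMeasurable GB volume := by
    have := hB.locallyIntegrableOn_deriv.aestronglyMeasurable
    simpa only [Opens.coe_mk, Measure.restrict_univ] using this
  -- componentwise scalar data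
  have hcoord : ∀ a : Fin 3, HasWeakFDerivOn (⟨Set.univ, isOpen_univ⟩ : Opens (EuclideanSpace ℝ (Fin 2))) volume
      (fun y => B y a) (fun y => (EuclideanSpace.proj a).comp (GB y)) := fun a => hasWeakFDerivOn_coord3 hB a
  have hL2 : ∀ a : Fin 3, LocallyIntegrable (fun y => (B y a) ^ 2) volume := by
    intro a
    refine hB2.mono ?_ (Eventually.of_forall fun y => ?_)
    · have hBm : AEStronglyMeasurable B volume := by
        have := hB.locallyIntegrableOn.aestronglyMeasurable
        simpa only [Opens.coe_mk, Measure.restrict_univ] using this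
      exact ((EuclideanSpace.proj a : EuclideanSpace ℝ (Fin 3) →L[ℝ] ℝ).continuous.comp_aestronglyMeasurable hBm).pow 2
    · rw [Real.norm_eq_abs, abs_of_nonneg (sq_nonneg _), Real.norm_eq_abs, abs_of_nonneg (sq_nonneg _),
        norm_sq_eq_sum_sq_fin_three]
      exact Finset.single_le_sum (fun b _ => sq_nonneg (B y b)) (Finset.mem_univ a)
  have hGa : ∀ a : Fin 3, Integrable (fun y => ∑ k : Fin 2,
      (((EuclideanSpace.proj a).comp (GB y)) (EuclideanSpace.single k (1:ℝ))) ^ 2) volume := by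
    intro a
    simpa only [ContinuousLinearMap.comp_apply, EuclideanSpace.coe_proj] using integrable_gradSq hGm hE a
  -- the scalar weak equation of component `a` is row (iii) at `a`
  have hEq : ∀ a : Fin 3, ∀ η : EuclideanSpace ℝ (Fin 2) → ℝ, ContDiff ℝ ∞ η → HasCompactSupport η →
      -(∫ y, ∑ k : Fin 2, fderiv ℝ η y (EuclideanSpace.single k (1:ℝ)) *
          ((EuclideanSpace.proj a).comp (GB y)) (EuclideanSpace.single k (1:ℝ))) =
        2 * ∫ y, η y * (((EuclideanSpace.proj (a + 1)).comp (GB y)) (EuclideanSpace.single 0 (1:ℝ)) *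
            ((EuclideanSpace.proj (a + 2)).comp (GB y)) (EuclideanSpace.single 1 (1:ℝ)) -
          ((EuclideanSpace.proj (a + 1)).comp (GB y)) (EuclideanSpace.single 1 (1:ℝ)) *
            ((EuclideanSpace.proj (a + 2)).comp (GB y)) (EuclideanSpace.single 0 (1:ℝ))) := by
    intro a η hη hηc
    have h := hH η hη hηc a
    simp only [ContinuousLinearMap.comp_apply, EuclideanSpace.coe_proj]
    rw [h]
    congr 1
    refine integral_congr_ae (Eventually.of_forall fun y => ?_)
    ring
  -- continuous representatives with the two-point bound, per component
  have hrep : ∀ a : Fin 3, ∃ ū : EuclideanSpace ℝ (Fin 2) → ℝ, Continuous ū ∧ ū =ᵐ[volume] (fun y => B y a) ∧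
      ∀ x₀ x₁, |ū x₀ - ū x₁| ≤ 1 / Real.pi *
        (Real.sqrt (∫ y, ∑ k : Fin 2, ((GB y (EuclideanSpace.single k (1:ℝ))) (a + 1)) ^ 2) *
         Real.sqrt (∫ y, ∑ k : Fin 2, ((GB y (EuclideanSpace.single k (1:ℝ))) (a + 2)) ^ 2)) := by
    intro a
    have h := doorTWO (fun y => B y a) (fun y => B y (a + 1)) (fun y => B y (a + 2))
      (fun y => (EuclideanSpace.proj a).comp (GB y)) (fun y => (EuclideanSpace.proj (a + 1)).comp (GB y))
      (fun y => (EuclideanSpace.proj (a + 2)).comp (GB y))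
      (hcoord a) (hcoord (a + 1)) (hcoord (a + 2)) (hL2 a) (hL2 (a + 1)) (hL2 (a + 2)) (hGa a) (hGa (a + 1)) (hGa (a + 2))
      (hEq a)
    simpa only [ContinuousLinearMap.comp_apply, EuclideanSpace.coe_proj] using h
  choose ū hūc hūae hū2 using hrep
  -- midpoint constants
  have hc : ∀ a : Fin 3, ∃ c : ℝ, ∀ x, |ū a x - c| ≤ 1 / (2 * Real.pi) *
      (Real.sqrt (∫ y, ∑ k : Fin 2, ((GB y (EuclideanSpace.single k (1:ℝ))) (a + 1)) ^ 2) *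
       Real.sqrt (∫ y, ∑ k : Fin 2, ((GB y (EuclideanSpace.single k (1:ℝ))) (a + 2)) ^ 2)) := by
    intro a
    obtain ⟨c, hc⟩ := exists_const_abs_sub_le_half (ū a) (hū2 a)
    refine ⟨c, fun x => (hc x).trans (le_of_eq ?_)⟩
    field_simp
  choose c hcb using hc
  -- the continuous bounded representative `B̄`
  set Bbar : EuclideanSpace ℝ (Fin 2) → EuclideanSpace ℝ (Fin 3) := fun y => WithLp.toLp 2 (fun a => ū a y) with hBbar_def
  have hBbar_apply : ∀ y a, Bbar y a = ū a y := fun y a => rfl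
  have hBbar_cont : Continuous Bbar :=
    (PiLp.continuous_toLp 2 (fun _ : Fin 3 => ℝ)).comp (continuous_pi fun a => hūc a)
  have hBbar_ae : Bbar =ᵐ[volume] B := by
    have h0 := hūae 0
    have h1 := hūae 1
    have h2 := hūae 2
    filter_upwards [h0, h1, h2] with y e0 e1 e2
    ext a
    fin_cases a
    · exact e0
    · exact e1
    · exact e2
  have hBbar_bdd : ∃ M : ℝ, ∀ y, ‖Bbar y‖ ≤ M := by
    -- each component is bounded: `|ū a y| ≤ |ū a 0| + (two-point constant)`
    have hKa : ∀ a : Fin 3, ∃ R : ℝ, ∀ y, |ū a y| ≤ R := by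
      intro a
      refine ⟨|ū a 0| + 1 / Real.pi *
        (Real.sqrt (∫ y, ∑ k : Fin 2, ((GB y (EuclideanSpace.single k (1:ℝ))) (a + 1)) ^ 2) *
         Real.sqrt (∫ y, ∑ k : Fin 2, ((GB y (EuclideanSpace.single k (1:ℝ))) (a + 2)) ^ 2)), fun y => ?_⟩
      have h := hū2 a y 0
      have : |ū a y| - |ū a 0| ≤ |ū a y - ū a 0| := abs_sub_abs_le_abs_sub _ _
      linarith
    choose R hR using hKa
    refine ⟨∑ a : Fin 3, R a, fun y => ?_⟩
    calc ‖Bbar y‖ ≤ |Bbar y 0| + |Bbar y 1| + |Bbar y 2| := norm_le_sum_abs_fin_three _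
      _ ≤ ∑ a : Fin 3, R a := by
          rw [Fin.sum_univ_three, hBbar_apply, hBbar_apply, hBbar_apply]
          linarith [hR 0 y, hR 1 y, hR 2 y]
  -- `B̄` carries the same weak gradient (a.e. modification)
  have hBbar : HasWeakFDerivOn (⟨Set.univ, isOpen_univ⟩ : Opens (EuclideanSpace ℝ (Fin 2))) volume Bbar GB :=
    MeyersSerrin.hasWeakFDerivOn_congr_ae hB (by simpa only [Opens.coe_mk, Measure.restrict_univ] using hBbar_ae)
      EventuallyEq.rfl
  -- the energy row at `B̄` (px3 g10's ✓`energy_le_abs`, the frozen `hEn` shape)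
  have hEn := PoincareLipschitzHSystemEnergyIdentity.energy_le_abs hBbar hE hH hBbar_cont hBbar_bdd c
  -- the oscillation row at `B̄` (everywhere, hence a.e.)
  have hOsc : ∀ a : Fin 3, ∀ᵐ y : EuclideanSpace ℝ (Fin 2), |Bbar y a - c a| ≤ 1 / (2 * Real.pi) *
      (Real.sqrt (∫ y, ∑ k : Fin 2, ((GB y (EuclideanSpace.single k (1:ℝ))) (a + 1)) ^ 2) *
       Real.sqrt (∫ y, ∑ k : Fin 2, ((GB y (EuclideanSpace.single k (1:ℝ))) (a + 2)) ^ 2)) :=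
    fun a => Eventually.of_forall fun y => by rw [hBbar_apply]; exact hcb a y
  exact energy_zero_of_osc_of_energyBound hGm hE hOsc hEn hΘ

end Summit.QuantumFields.YangMills.Theorems.PoincareLipschitzHSystemGapAtThreePiOfDoors

end
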